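import Summits.Ventures.CertifiedArithmetic.LowPrec.DoubleRoundingFMA
import Summits.Ventures.CertifiedArithmetic.LowPrec.DoubleRoundingWide

/-!
# Slips of a double rounding without the bias hypothesis; half an ulp of a subnormal result

HONEST FRAMING: certified error envelopes and provably optimal rounding/accumulation schemes for
low-precision formats under stated cost models; every table by two implementations; no hardware
or vendor claims.

Two format-generic lemmas used by THEOREM D-div (`DoubleRoundingDivision.lean`), both for the
saturating round-to-nearest-even `roundNE` of this packet with subnormals kept:

* `slip_midpoint_of_pos_of_qexp_lt` — Property 2.1 of [MartinDorelMelquiondMuller2013] for format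
  records WITHOUT the hypothesis `bias φ ≤ bias ψ` of `slip_midpoint_of_pos`: under
  `P_φ + 1 ≤ P_ψ`, `qexp ψ < qexp φ`, `maxRat φ ≤ maxRat ψ`, a slip `fl_φ (fl_ψ x) ≠ fl_φ x` at
  `x > 0` forces `fl_ψ x` to be the midpoint of the two neighbours `v < x < u` of `φ`, `x ≠ fl_ψ x`
  (the midpoints of the two lowest binades of `φ` are values of `ψ` because
  `quantum φ = 2^D quantum ψ` with `D ≥ 1`, `exists_toRat_eq_midpoint_of_qexp_lt`). The P3109
  records `binary8p3` (bias 16) inside `binary16` (bias 15) need this form.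
* `abs_sub_roundNE_le_half_ulp_of_pos` — a positive correctly rounded result below the top of
  its format is within `2^(expCode-1) · quantum / 2` of the input, ALSO when it is subnormal
  (`expCode = 0`, the ulp being the quantum; `abs_sub_roundNE_le_half_ulp` is the normal case).

PLACEMENT: restatements for the format records of this packet of textbook facts
[MullerEtAl2018, §2.2.1; BoldoMelquiond2008, §III]; nothing here is claimed new.
-/

namespace Summit.Ventures.CertifiedArithmetic

open Literature.ComputerArithmetic.FloatingPoint
open Literature.ComputerArithmetic.FloatingPoint.Format
open Literature.ComputerArithmetic.FloatingPoint.MiniFloat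

/-! ## §1 Midpoints and slips without the bias hypothesis -/

/-- MIDPOINTS OF `φ` ARE VALUES OF `ψ` under `P_φ + 1 ≤ P_ψ`, `qexp ψ < qexp φ`,
`maxRat φ ≤ maxRat ψ` (no bias hypothesis): for consecutive `0 ≤ v < u = v + ulp(v)` of `φ` the
midpoint `v + ulp(v)/2` is a value of `ψ` — above the two lowest binades by
`exists_toRat_eq_midpoint_of_qexp_le`, in them because `ulp(v) = quantum φ = 2^D quantum ψ` with
`D ≥ 1` and `(2·v.scaledMag + 1)·2^(D-1) < 2^(P_φ + 1)·2^(D-1) ≤ 2^P_ψ·2^(D-1)`.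
[cite: BoldoMelquiond2008, §III] -/
theorem exists_toRat_eq_midpoint_of_qexp_lt {φ ψ : Format} (hm : φ.manBits + 1 ≤ ψ.manBits)
    (hq1 : ψ.qexp + 1 ≤ φ.qexp) (hmax : φ.maxRat ≤ ψ.maxRat) {v u : MiniFloat φ}
    (hv : 0 ≤ v.toRat) (hu : u.toRat = v.toRat + 2 ^ (v.expCode - 1) * φ.quantum) :
    ∃ z : MiniFloat ψ, z.toRat = v.toRat + 2 ^ (v.expCode - 1) * φ.quantum / 2 := by
  by_cases he : 2 ≤ v.expCode
  · exact exists_toRat_eq_midpoint_of_qexp_le hm (by omega) hmax hv he hu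
  · have hqφ := φ.quantum_pos
    have hqψ := ψ.quantum_pos
    have he0 : v.expCode - 1 = 0 := by omega
    rw [he0, pow_zero, one_mul] at hu ⊢
    set D := (φ.qexp - ψ.qexp).toNat with hDdef
    have hDq : φ.quantum = 2 ^ D * ψ.quantum := quantum_eq_two_pow_mul (by omega)
    obtain ⟨d, hd⟩ : ∃ d, D = d + 1 := ⟨D - 1, by omega⟩
    have hS : v.scaledMag < 2 ^ (φ.manBits + 1) := by
      have := scaledMag_lt_pow_ulpExp v; rwa [he0, add_zero] at this
    set n : ℕ := (2 * v.scaledMag + 1) * 2 ^ d with hn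
    have hval : (n : ℚ) * ψ.quantum = v.toRat + φ.quantum / 2 := by
      rw [toRat_eq_toInt_mul, toInt_eq_scaledMag_of_nonneg hv, hDq, hd, hn, pow_succ]
      push_cast; ring
    have hrep : ψ.Representable n := by
      refine representable_of_pow_dvd (g := d) (Dvd.intro_left _ rfl) ?_ ?_
      · have h3 : 2 ^ (φ.manBits + 2) ≤ 2 ^ (ψ.manBits + 1) :=
          Nat.pow_le_pow_right (by norm_num) (by omega)
        have h4 : 2 * v.scaledMag + 1 ≤ 2 ^ (ψ.manBits + 1) := by
          rw [pow_succ, pow_succ] at h3; rw [pow_succ] at hS; omega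
        calc n = (2 * v.scaledMag + 1) * 2 ^ d := rfl
          _ ≤ 2 ^ (ψ.manBits + 1) * 2 ^ d := Nat.mul_le_mul_right _ h4
          _ = 2 ^ (ψ.manBits + 1 + d) := by ring
      · have h1 : (n : ℚ) * ψ.quantum ≤ (ψ.maxScaled : ℚ) * ψ.quantum := by
          rw [hval]
          calc v.toRat + φ.quantum / 2 ≤ u.toRat := by rw [hu]; linarith
            _ ≤ φ.maxRat := le_trans (le_abs_self _) (abs_toRat_le_maxRat u)
            _ ≤ ψ.maxRat := hmax
            _ = (ψ.maxScaled : ℚ) * ψ.quantum := rfl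
        exact_mod_cast le_of_mul_le_mul_right h1 hqψ
    have hpos : 0 ≤ v.toRat + φ.quantum / 2 := by linarith
    exact exists_toRat_eq_of_abs_eq_natMul hrep (by rw [abs_of_nonneg hpos, hval])

/-- PROPERTY 2.1 FOR FORMAT RECORDS WITHOUT THE BIAS HYPOTHESIS (positive inputs): for formats
with `P_φ + 1 ≤ P_ψ`, `qexp ψ < qexp φ`, `maxRat φ ≤ maxRat ψ` and a rational `x > 0` at which the
double rounding slips, `fl_φ (fl_ψ x) ≠ fl_φ x`, there are consecutive values `0 ≤ v < u` of `φ`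
with `v < x < u` and `fl_ψ x = (v + u)/2 ≠ x` (the proof of `slip_midpoint_of_pos` verbatim, the
midpoint supplied by `exists_toRat_eq_midpoint_of_qexp_lt`).
[cite: MartinDorelMelquiondMuller2013, Property 2.1] -/
theorem slip_midpoint_of_pos_of_qexp_lt {φ ψ : Format} (hm1 : φ.manBits + 1 ≤ ψ.manBits)
    (hq1 : ψ.qexp + 1 ≤ φ.qexp) (hmax : φ.maxRat ≤ ψ.maxRat) {x : ℚ} (hx : 0 < x)
    (h : (roundNE φ (roundNE ψ x).toRat).toRat ≠ (roundNE φ x).toRat) :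
    ∃ v u : MiniFloat φ, 0 ≤ v.toRat ∧ v.toRat < x ∧ x < u.toRat ∧
      (∀ y : MiniFloat φ, y.toRat ≤ v.toRat ∨ u.toRat ≤ y.toRat) ∧
      (roundNE ψ x).toRat = (v.toRat + u.toRat) / 2 ∧ x ≠ (roundNE ψ x).toRat := by
  have hqφ := φ.quantum_pos
  have hmle : φ.manBits ≤ ψ.manBits := by omega
  have hq : ψ.qexp ≤ φ.qexp := by omega
  have hex : ¬ ∃ z : MiniFloat ψ, z.toRat = x :=
    fun hex => h (toRat_roundNE_roundNE_of_exists hex)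
  have hbig : ¬ φ.maxRat ≤ x := by
    intro hbig
    apply h
    have htop : ∃ z : MiniFloat ψ, z.toRat = φ.maxRat := by
      obtain ⟨z, hz⟩ := exists_toRat_eq_of_le hmle hq hmax (top φ)
      exact ⟨z, by rw [hz, toRat_top]⟩
    have hw : φ.maxRat ≤ (roundNE ψ x).toRat := by
      have h1 := toRat_roundNE_mono (φ := ψ) hbig
      rwa [toRat_roundNE_of_exists htop] at h1
    rw [toRat_roundNE_of_maxRat_le_pos hw, toRat_roundNE_of_maxRat_le_pos hbig]
  have hbig' : x < φ.maxRat := not_le.mp hbig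
  have hnsφ : ¬ ∃ y : MiniFloat φ, y.toRat = x := by
    rintro ⟨y, hy⟩
    obtain ⟨z, hz⟩ := exists_toRat_eq_of_le hmle hq hmax y
    exact hex ⟨z, hz.trans hy⟩
  obtain ⟨hv0, hvs, hsu, ⟨u, hu⟩, hgap⟩ := roundDown_bracket hx hbig' hnsφ
  set v := roundDown φ x with hv_def
  set G := 2 ^ (v.expCode - 1) * φ.quantum with hG_def
  have hG : 0 < G := by positivity
  have hvψ : ∃ z : MiniFloat ψ, z.toRat = v.toRat := exists_toRat_eq_of_le hmle hq hmax v
  have huψ : ∃ z : MiniFloat ψ, z.toRat = v.toRat + G := by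
    obtain ⟨z, hz⟩ := exists_toRat_eq_of_le hmle hq hmax u
    exact ⟨z, hz.trans hu⟩
  have hMψ : ∃ z : MiniFloat ψ, z.toRat = v.toRat + G / 2 :=
    exists_toRat_eq_midpoint_of_qexp_lt hm1 hq1 hmax hv0 hu
  have hsM : x ≠ v.toRat + G / 2 := by
    intro h'; obtain ⟨z, hz⟩ := hMψ; exact hex ⟨z, hz.trans h'.symm⟩
  have hgap' : ∀ y : MiniFloat φ, y.toRat ≤ v.toRat ∨ u.toRat ≤ y.toRat := by
    intro y; rw [hu]; exact hgap y
  set w := (roundNE ψ x).toRat with hw_def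
  suffices hwEq : w = v.toRat + G / 2 by
    refine ⟨v, u, hv0, hvs, by rw [hu]; exact hsu, hgap', by rw [hwEq, hu]; ring, ?_⟩
    rw [hwEq]; exact hsM
  rcases lt_or_gt_of_ne hsM with hlt | hgt
  · have hwv : v.toRat ≤ w := by
      have := toRat_roundNE_mono (φ := ψ) hvs.le; rwa [toRat_roundNE_of_exists hvψ] at this
    have hwM : w ≤ v.toRat + G / 2 := by
      have := toRat_roundNE_mono (φ := ψ) hlt.le; rwa [toRat_roundNE_of_exists hMψ] at this
    rcases eq_or_lt_of_le hwM with hwEq | hwLt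
    · exact hwEq
    · exfalso; apply h
      rw [toRat_roundNE_eq_of_forall_lt ⟨v, rfl⟩ (forall_lt_of_mem_low hgap hwv hwLt),
        toRat_roundNE_eq_of_forall_lt ⟨v, rfl⟩ (forall_lt_of_mem_low hgap hvs.le hlt)]
  · have hwu : w ≤ v.toRat + G := by
      have := toRat_roundNE_mono (φ := ψ) hsu.le; rwa [toRat_roundNE_of_exists huψ] at this
    have hwM : v.toRat + G / 2 ≤ w := by
      have := toRat_roundNE_mono (φ := ψ) hgt.le; rwa [toRat_roundNE_of_exists hMψ] at this
    rcases eq_or_lt_of_le hwM with hwEq | hwGt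
    · exact hwEq.symm
    · exfalso; apply h
      rw [toRat_roundNE_eq_of_forall_lt ⟨u, rfl⟩ (forall_lt_of_mem_high hu hgap hwGt hwu),
        toRat_roundNE_eq_of_forall_lt ⟨u, rfl⟩ (forall_lt_of_mem_high hu hgap hgt hsu.le)]

/-! ## §2 A correctly rounded positive result — normal or subnormal — is within half its ulp -/

/-- If `fl_ψ x > 0` lies below some value of `ψ`, then `|x - fl_ψ x| ≤ 2^(expCode-1) · quantum / 2`
— half the ulp of the result, the ulp of a SUBNORMAL result (`expCode = 0`) being the quantum
(both neighbours of the result exist and are no closer to `x`; `abs_sub_roundNE_le_half_ulp` is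
the normal case). [folklore; cite: MullerEtAl2018, §2.2.1] -/
theorem abs_sub_roundNE_le_half_ulp_of_pos {ψ : Format} {x : ℚ} {z : MiniFloat ψ}
    (h0 : 0 < (roundNE ψ x).toRat) (hz : (roundNE ψ x).toRat < z.toRat) :
    |x - (roundNE ψ x).toRat| ≤ 2 ^ ((roundNE ψ x).expCode - 1) * ψ.quantum / 2 := by
  set y := roundNE ψ x with hy
  have hQ := ψ.quantum_pos
  have hB : (0:ℚ) < 2 ^ (y.expCode - 1) * ψ.quantum := by positivity
  obtain ⟨u, hu⟩ := exists_toRat_eq_add_ulp h0.le hz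
  have hyQ : y.toRat = (y.scaledMag : ℚ) * ψ.quantum := by
    rw [toRat_eq_toInt_mul, toInt_eq_scaledMag_of_nonneg h0.le]; push_cast; rfl
  have hlow : 2 ^ (y.expCode - 1) ≤ y.scaledMag := by
    rcases Nat.lt_or_ge y.expCode 1 with hE | hE
    · have hS : y.scaledMag ≠ 0 := by
        intro hS; rw [hyQ, hS] at h0; simp at h0
      have he : y.expCode - 1 = 0 := by omega
      rw [he, pow_zero]; exact Nat.pos_of_ne_zero hS
    · exact le_trans (Nat.pow_le_pow_right (by norm_num) (by omega))
        (pow_le_scaledMag_of_expCode_pos y hE)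
  obtain ⟨V, hV⟩ := pow_ulpExp_dvd_scaledMag y
  have hdvd : 2 ^ (y.expCode - 1) ∣ y.scaledMag - 2 ^ (y.expCode - 1) :=
    ⟨V - 1, by rw [hV, Nat.mul_sub_one]⟩
  have hrep : ψ.Representable (y.scaledMag - 2 ^ (y.expCode - 1)) :=
    representable_of_pow_dvd (g := y.expCode - 1) hdvd
      ((Nat.sub_le _ _).trans (scaledMag_lt_pow_ulpExp y).le)
      ((Nat.sub_le _ _).trans y.scaledMag_le_maxScaled)
  obtain ⟨w, hw⟩ := exists_toRat_eq_intCast_mul (φ := ψ)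
    ((y.scaledMag - 2 ^ (y.expCode - 1) : ℕ) : ℤ) (by rwa [Int.natAbs_natCast])
  have hw' : w.toRat = y.toRat - 2 ^ (y.expCode - 1) * ψ.quantum := by
    rw [hw, hyQ]
    push_cast [Nat.cast_sub hlow]; ring
  rw [abs_le]
  constructor
  · by_cases hxw : w.toRat ≤ x
    · have h1 := roundNE_nearest x w
      rw [← hy, abs_of_nonneg (by linarith : 0 ≤ x - w.toRat)] at h1
      have h2 : y.toRat - x ≤ |x - y.toRat| := by rw [abs_sub_comm]; exact le_abs_self _
      linarith
    · have h1 := toRat_roundNE_mono (φ := ψ) (le_of_lt (not_le.mp hxw))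
      rw [toRat_roundNE_toRat, ← hy] at h1; exfalso; linarith
  · by_cases hxu : x ≤ u.toRat
    · have h1 := roundNE_nearest x u
      rw [← hy, abs_of_nonpos (by linarith : x - u.toRat ≤ 0)] at h1
      have h2 : x - y.toRat ≤ |x - y.toRat| := le_abs_self _
      linarith
    · have h1 := toRat_roundNE_mono (φ := ψ) (le_of_lt (not_le.mp hxu))
      rw [toRat_roundNE_toRat, ← hy] at h1; exfalso; linarith

end Summit.Ventures.CertifiedArithmetic
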